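import Summits.QuantumFields.BalabanUV.T4Continuum.Spine.NE3.LandauProjectionB8
import Summits.QuantumFields.BalabanUV.T4Continuum.Support.NE3CurlPairedResidualEnd
import Summits.QuantumFields.BalabanUV.T4Continuum.Support.NE3PureGaugeFirstVariation
import Summits.QuantumFields.BalabanUV.T4Continuum.Support.MinimalActionLevels
import Summits.QuantumFields.BalabanUV.T4Continuum.Support.NE3LiftDefectCorrection
import HarnessLib

/-!
# T⁴ programme, node NE3 — REPAIR R24 (γ): THE LANDAU LINEAR NORMAL PART `Nn := Y + gaugeDir W λ` — its ℓ¹-letters (R3) `Σ‖curl‖` and (R4) `dirL1` from the letters of `Y`,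
# the covariant divergence of `Y`, and the Landau relation (Cauchy–Schwarz over the torus: the constants carry `√(card n·N^d)`), k-FREE

Cell `pub-balaban-gaps` (YM blitz, track G2, seat `ne3`, unit `pub-balaban-gaps-ne3`; writer prover-pub-balaban-gaps-ne3-g3-0, 2026-08-23), census
`run/shared/lean/pub/pub-balaban-gaps/ne/NE3.md` §4 R24.  Companion of `Spine/NE3/NormalPartB8` ((R1), (R2)); inputs `Spine/NE3/LandauProjectionB8.sum_nhsNormSq_gaugeDir_le_of_isLandauB8`, K6-Ξ Poincaré
`NE3CornerGaugePoincare`, `NE3CurlOfGaugeDir.norm_curlAt_gaugeDir_le`, `NE3CurlPairedResidualEnd.dirL1_le_sqrt_mul_sqrt_dirSq`, `NE3LiftDefectCorrection.dirL1_add_le`,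
`NE3PureGaugeFirstVariation.curl_add` (the correction's bounds stand alone in `Spine/NE3/LandauCorrectionLettersB8`).

CONTENT ([folklore]; 0 sorry; no `def`): `sqrt_dirSq_le_dirL1`, `sum_norm_curl_add_le` (Cauchy–Schwarz `√A·√B ≤ T` from `A·B ≤ T²` is `Literature…ASPTheorem2.sqrt_mul_sqrt_le_of_le_sq`; inlined here); **`landauNormalPart_R4`** (`dirL1 Nn ≤ (c₄ + 2√(d·card n·c_V·N^d))·(M^d∕M)·dirL1 φ`),
**`landauNormalPart_R3`** (`Σ_{perWin}‖curl W Nn‖ ≤ (c₃ + 8·card(Plane)·√(card n·c_V·N^d))·(M^d∕M²)·dirL1 φ`, regime `M²x ≤ 1`).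

HONEST FRAMING.  ℓ¹-bookkeeping over landed lemmas on OUR objects; the SUP letters of the correction are NOT given (F5); nothing about Bałaban's minimisers; the chart supplier's sup letters,
Π-REG, (P♮), (RES♯), the covariant root and **NE3 are NOT proved**; spine PROVED 0∕9; finite T⁴ rung (B)+1 — NOT infinite volume, NOT mass gap, NOT `BetaPertH`, NOT Clay.  PLACEMENT:
`Summits/QuantumFields/BalabanUV/T4Continuum/Spine/NE3/`; imports accepted modules only; moves nothing.  HONEST DEPENDENCY: continuum YM on T⁴ ⇐ BetaPertH ∧ nine spine estimates (0/9 proved);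
BetaPertH ⇐ (D1) ∧ (D4) ∧ CAP+tail; G-an2-4 gates asym, D1 and NE2/3/4.
-/

set_option autoImplicit false

open scoped BigOperators Matrix Matrix.Norms.L2Operator
open NormedSpace Finset

namespace Summit.QuantumFields.BalabanUV.T4Continuum.NE3.NormalPartB8L1

open Literature.MathematicalPhysics.QuantumFieldTheory.Balaban1983to89
open B7Prop1Explicit B7Prop2Explicit MatrixNorms
open T4AveragingDeficitWall (Ad IsUnitaryCfg IsSkewDir SmallField curl curlSq dirSq dirL1)
open T4AveragingDeficitWallBoundary (IsPeriodicCfg periodBox mem_periodBox card_periodBox)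
open AveragingDeficitPeriodicCounting (IsPeriodicDir)
open AveragingDeficitTwoLevelPrep (prop1Radius)
open AveragingDeficitMultiLevelPrep (LevelSmall)
open BlockAveragePushDirGauge (gaugeDir)
open MinimalActionLevels (perWin)
open NE3CovariantWeitzenbock (covDiv)
open NE3TangentCovariantTower (QbarIter)
open NE3PureGaugeFirstVariation (curl_add)
open NE3LiftDefectCorrection (dirL1_add_le)
open SpreadLift (loopRad)
open NE3.PairLandauB8 (avgKernelGauges IsLandauB8)
open NE3.LandauProjectionB8 (sum_nhsNormSq_gaugeDir_le_of_isLandauB8)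
open NE3CornerGaugePoincare (sum_nhsNormSq_le_four_mul_of_bmeanIterW_eq_zero)
open NE3CurlOfGaugeDir (norm_curlAt_gaugeDir_le)
open NE3CurlPairedResidualEnd (dirL1_le_sqrt_mul_sqrt_dirSq)
open NE3CovariantBlockMean (bmeanIterW)
open NE3.PairLandauB8 (mem_avgKernelGauges_iff)

noncomputable section

variable {d : ℕ} {n : Type*} [Fintype n] [DecidableEq n]

/-! ## §1 Small lemmas -/

/-- `√(dirSq Z F) ≤ dirL1 Z F` (a sum of squares of non-negative reals is at most the square of their sum). [folklore] -/
theorem sqrt_dirSq_le_dirL1 (Z : Site d → Fin d → Matrix n n ℂ) (F : Finset (Site d)) : Real.sqrt (dirSq Z F) ≤ dirL1 Z F := by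
  have hL1 : 0 ≤ dirL1 Z F := by unfold dirL1; positivity
  refine Real.sqrt_le_iff.mpr ⟨hL1, ?_⟩
  unfold dirSq dirL1
  have hin : ∀ y ∈ F, ∀ μ : Fin d, ‖Z y μ‖ ≤ ∑ y' ∈ F, ∑ μ' : Fin d, ‖Z y' μ'‖ := by
    intro y hy μ
    exact (Finset.single_le_sum (f := fun μ' => ‖Z y μ'‖) (fun _ _ => norm_nonneg _) (Finset.mem_univ μ)).trans
      (Finset.single_le_sum (f := fun y' => ∑ μ' : Fin d, ‖Z y' μ'‖) (fun _ _ => Finset.sum_nonneg fun _ _ => norm_nonneg _) hy)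
  calc ∑ y ∈ F, ∑ μ : Fin d, ‖Z y μ‖ ^ 2 ≤ ∑ y ∈ F, ∑ μ : Fin d, ‖Z y μ‖ * ∑ y' ∈ F, ∑ μ' : Fin d, ‖Z y' μ'‖ :=
        Finset.sum_le_sum fun y hy => Finset.sum_le_sum fun μ _ => by
          rw [sq]; exact mul_le_mul_of_nonneg_left (hin y hy μ) (norm_nonneg _)
    _ = (∑ y ∈ F, ∑ μ : Fin d, ‖Z y μ‖) ^ 2 := by
        rw [sq, Finset.sum_mul]
        exact Finset.sum_congr rfl fun y _ => by rw [Finset.sum_mul]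

/-- `Σ_p ‖curl V (Y + D) p‖ ≤ Σ_p ‖curl V Y p‖ + Σ_p ‖curl V D p‖`. [folklore] -/
theorem sum_norm_curl_add_le (V : Site d → Fin d → (Matrix n n ℂ)ˣ) (Y D : Site d → Fin d → Matrix n n ℂ) (S : Finset (T4AveragingDeficitWall.Plaq d)) :
    ∑ p ∈ S, ‖curl V (Y + D) p‖ ≤ ∑ p ∈ S, ‖curl V Y p‖ + ∑ p ∈ S, ‖curl V D p‖ := by
  rw [← Finset.sum_add_distrib]
  exact Finset.sum_le_sum fun p _ => by rw [curl_add]; exact norm_add_le _ _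

/-! ## §2 The ℓ¹-letters of `Nn := Y + gaugeDir W λ` -/

section NormalPart

variable [Nonempty n] {L N : ℕ} [NeZero N] (hL : 2 ≤ L) (hN : 1 ≤ N) (j : ℕ) {W : Site d → Fin d → (Matrix n n ℂ)ˣ} {x : ℝ}
  (hWu : IsUnitaryCfg W) (hWP : IsPeriodicCfg W ((N * L ^ (j + 1) : ℕ) : ℤ)) (hx : 0 ≤ x) (hs : LevelSmall d L j x) (hWx : SmallField W x)
  (hε : ((L : ℝ) ^ (j + 1)) ^ 2 * x ≤ 1)
  (hPs : 8 * d * (((L : ℝ) ^ (j + 1)) * (((d : ℝ) - 1) * (((L : ℝ) ^ (j + 1)) - 1) * x)) ^ 2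
    + 2 * (Fintype.card n * (4 * (d : ℝ) ^ 2 * ((L : ℝ) ^ (j + 1) - 1) ^ 2 * x + 16 * d * loopRad d L ((prop1Radius d L)^[j] x)) ^ 2)
      ≤ 1 / 2)
  {Z Y : Site d → Fin d → Matrix n n ℂ} (hYP : IsPeriodicDir Y ((N * L ^ (j + 1) : ℕ) : ℤ))
  {lam : Site d → Matrix n n ℂ} (hlam : lam ∈ avgKernelGauges (d := d) (n := n) L N (j + 1) W)
  (hLan : IsLandauB8 (d := d) L N (j + 1) W (fun y κ => Y y κ + gaugeDir W lam y κ))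
  {V cV c₃ c₄ : ℝ} (hV : ∑ y ∈ periodBox (d := d) (N * L ^ (j + 1)), nhsNormSq (covDiv W Y y) ≤ V)
  (hcV : 0 ≤ cV) (hVφ : V ≤ cV * (((L : ℝ) ^ (j + 1)) ^ d / ((L : ℝ) ^ (j + 1)) ^ 4) * dirSq (QbarIter L (j + 1) W Z) (periodBox (d := d) N))
  (hY3 : ∑ p ∈ perWin d (N * L ^ (j + 1)), ‖curl W Y p‖
    ≤ c₃ * (((L : ℝ) ^ (j + 1)) ^ d / ((L : ℝ) ^ (j + 1)) ^ 2) * dirL1 (QbarIter L (j + 1) W Z) (periodBox (d := d) N))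
  (hY4 : dirL1 Y (periodBox (d := d) (N * L ^ (j + 1))) ≤ c₄ * (((L : ℝ) ^ (j + 1)) ^ d / (L : ℝ) ^ (j + 1)) * dirL1 (QbarIter L (j + 1) W Z) (periodBox (d := d) N))

include hL hN hWu hWP hx hs hWx hPs hYP hlam hLan hV hcV hVφ hY4 in
omit [NeZero N] in
/-- **(R4)**: `dirL1 Nn (periodBox (N·M)) ≤ (c₄ + 2√(d·card n·c_V·N^d))·(M^d∕M)·dirL1 φ (periodBox N)`
(`dirL1 (gaugeDir W λ) ≤ √(d(NM)^d)·√(card n·4M²·V)`, `V ≤ c_V·M^{d−4}·dirSq φ`, `√dirSq φ ≤ dirL1 φ`, `(NM)^d·M²·M^{d−4} = N^d·(M^d∕M)²`). [folklore] -/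
theorem landauNormalPart_R4 :
    dirL1 (fun y μ => Y y μ + gaugeDir W lam y μ) (periodBox (d := d) (N * L ^ (j + 1)))
      ≤ (c₄ + 2 * Real.sqrt ((d : ℝ) * Fintype.card n * cV * (N : ℝ) ^ d)) * (((L : ℝ) ^ (j + 1)) ^ d / (L : ℝ) ^ (j + 1))
          * dirL1 (QbarIter L (j + 1) W Z) (periodBox (d := d) N) := by
  set M : ℝ := (L : ℝ) ^ (j + 1) with hMdef
  have hM0 : 0 < M := by rw [hMdef]; positivity
  set Dφ : ℝ := dirSq (QbarIter L (j + 1) W Z) (periodBox (d := d) N) with hDφ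
  set L1 : ℝ := dirL1 (QbarIter L (j + 1) W Z) (periodBox (d := d) N) with hL1def
  have hDφ0 : 0 ≤ Dφ := by rw [hDφ]; unfold dirSq; positivity
  have hL10 : 0 ≤ L1 := by rw [hL1def]; unfold dirL1; positivity
  have hsq : Dφ ≤ L1 ^ 2 := by
    have h := sqrt_dirSq_le_dirL1 (QbarIter L (j + 1) W Z) (periodBox (d := d) N)
    rw [← hDφ, ← hL1def] at h
    have h2 := pow_le_pow_left₀ (Real.sqrt_nonneg _) h 2
    rwa [Real.sq_sqrt hDφ0] at h2
  have hNM : (((N * L ^ (j + 1) : ℕ) : ℝ)) ^ d = (N : ℝ) ^ d * M ^ d := by rw [hMdef]; push_cast; ring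
  -- the correction in ℓ¹: Cauchy–Schwarz, op-norm² ≤ card n·nhs², γ3's letter
  have hG := sum_nhsNormSq_gaugeDir_le_of_isLandauB8 hL hN j hWu hWP hx hs hWx hPs hYP hlam hLan
  have hD1 : dirSq (gaugeDir W lam) (periodBox (d := d) (N * L ^ (j + 1)))
      ≤ Fintype.card n * (4 * ((L : ℝ) ^ (j + 1)) ^ 2 * ∑ y ∈ periodBox (d := d) (N * L ^ (j + 1)), nhsNormSq (covDiv W Y y)) := by
    unfold dirSq
    calc ∑ y ∈ periodBox (d := d) (N * L ^ (j + 1)), ∑ κ : Fin d, ‖gaugeDir W lam y κ‖ ^ 2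
        ≤ ∑ y ∈ periodBox (d := d) (N * L ^ (j + 1)), ∑ κ : Fin d, Fintype.card n * nhsNormSq (gaugeDir W lam y κ) :=
          Finset.sum_le_sum fun y _ => Finset.sum_le_sum fun κ _ => opNorm_sq_le_card_mul_nhsNormSq _
      _ = Fintype.card n * ∑ y ∈ periodBox (d := d) (N * L ^ (j + 1)), ∑ κ : Fin d, nhsNormSq (gaugeDir W lam y κ) := by
          rw [Finset.mul_sum]; exact Finset.sum_congr rfl fun y _ => by rw [Finset.mul_sum]
      _ ≤ _ := mul_le_mul_of_nonneg_left hG (Nat.cast_nonneg _)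
  have hD4 : dirL1 (gaugeDir W lam) (periodBox (d := d) (N * L ^ (j + 1)))
      ≤ Real.sqrt ((d : ℝ) * (((N * L ^ (j + 1) : ℕ) : ℝ)) ^ d)
          * Real.sqrt (Fintype.card n * (4 * ((L : ℝ) ^ (j + 1)) ^ 2 * ∑ y ∈ periodBox (d := d) (N * L ^ (j + 1)), nhsNormSq (covDiv W Y y))) :=
    (dirL1_le_sqrt_mul_sqrt_dirSq (N * L ^ (j + 1)) (gaugeDir W lam)).trans
      (mul_le_mul_of_nonneg_left (Real.sqrt_le_sqrt hD1) (Real.sqrt_nonneg _))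
  -- the correction: `√A·√B ≤ T`
  set T : ℝ := 2 * Real.sqrt ((d : ℝ) * Fintype.card n * cV * (N : ℝ) ^ d) * (M ^ d / M) * L1 with hT
  have hT0 : 0 ≤ T := by rw [hT]; positivity
  have hA0 : 0 ≤ (d : ℝ) * (((N * L ^ (j + 1) : ℕ) : ℝ)) ^ d := by positivity
  have hB : Fintype.card n * (4 * ((L : ℝ) ^ (j + 1)) ^ 2 * ∑ y ∈ periodBox (d := d) (N * L ^ (j + 1)), nhsNormSq (covDiv W Y y))
      ≤ Fintype.card n * (4 * M ^ 2 * (cV * (M ^ d / M ^ 4) * Dφ)) :=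
    mul_le_mul_of_nonneg_left (mul_le_mul_of_nonneg_left (hV.trans hVφ) (by positivity)) (Nat.cast_nonneg _)
  have hAB : (d : ℝ) * (((N * L ^ (j + 1) : ℕ) : ℝ)) ^ d * (Fintype.card n * (4 * M ^ 2 * (cV * (M ^ d / M ^ 4) * Dφ))) ≤ T ^ 2 := by
    rw [hNM, hT, mul_pow, mul_pow, mul_pow, Real.sq_sqrt (by positivity)]
    have hcoef : 0 ≤ (2 : ℝ) ^ 2 * ((d : ℝ) * Fintype.card n * cV * (N : ℝ) ^ d) * (M ^ d / M) ^ 2 := by positivity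
    calc (d : ℝ) * ((N : ℝ) ^ d * M ^ d) * (Fintype.card n * (4 * M ^ 2 * (cV * (M ^ d / M ^ 4) * Dφ)))
        = (2 : ℝ) ^ 2 * ((d : ℝ) * Fintype.card n * cV * (N : ℝ) ^ d) * (M ^ d / M) ^ 2 * Dφ := by field_simp; ring
      _ ≤ (2 : ℝ) ^ 2 * ((d : ℝ) * Fintype.card n * cV * (N : ℝ) ^ d) * (M ^ d / M) ^ 2 * L1 ^ 2 := mul_le_mul_of_nonneg_left hsq hcoef
  have hDcorr : dirL1 (gaugeDir W lam) (periodBox (d := d) (N * L ^ (j + 1))) ≤ T := by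
    refine hD4.trans ((mul_le_mul_of_nonneg_left (Real.sqrt_le_sqrt hB) (Real.sqrt_nonneg _)).trans ?_)
    rw [← Real.sqrt_mul hA0]
    exact (Real.sqrt_le_sqrt hAB).trans (le_of_eq (Real.sqrt_sq hT0))
  have hsum := dirL1_add_le Y (gaugeDir W lam) (periodBox (d := d) (N * L ^ (j + 1)))
  have heq : dirL1 (fun y μ => Y y μ + gaugeDir W lam y μ) (periodBox (d := d) (N * L ^ (j + 1)))
      = dirL1 (Y + gaugeDir W lam) (periodBox (d := d) (N * L ^ (j + 1))) := rfl
  rw [heq]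
  refine hsum.trans ((add_le_add hY4 hDcorr).trans (le_of_eq ?_))
  rw [hT]; ring

include hL hN hWu hWP hx hs hWx hε hPs hYP hlam hLan hV hcV hVφ hY3 in
omit [NeZero N] in
/-- **(R3)**: `Σ_{p ∈ perWin d (N·M)} ‖curl W Nn p‖ ≤ (c₃ + 8·card(Plane)·√(card n·c_V·N^d))·(M^d∕M²)·dirL1 φ (periodBox N)`
(`Σ‖curl(gaugeDir W λ)‖ ≤ 2x·card(Plane)·√((NM)^d)·√(card n·16M⁴·V)`, `x²M⁴ ≤ 1`, `V ≤ c_V·M^{d−4}·dirSq φ`, `√dirSq φ ≤ dirL1 φ`). [folklore] -/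
theorem landauNormalPart_R3 :
    ∑ p ∈ perWin d (N * L ^ (j + 1)), ‖curl W (fun y μ => Y y μ + gaugeDir W lam y μ) p‖
      ≤ (c₃ + 8 * Fintype.card (T4AveragingDeficitWall.Plane d) * Real.sqrt (Fintype.card n * cV * (N : ℝ) ^ d))
          * (((L : ℝ) ^ (j + 1)) ^ d / ((L : ℝ) ^ (j + 1)) ^ 2) * dirL1 (QbarIter L (j + 1) W Z) (periodBox (d := d) N) := by
  set M : ℝ := (L : ℝ) ^ (j + 1) with hMdef
  have hM0 : 0 < M := by rw [hMdef]; positivity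
  set Dφ : ℝ := dirSq (QbarIter L (j + 1) W Z) (periodBox (d := d) N) with hDφ
  set L1 : ℝ := dirL1 (QbarIter L (j + 1) W Z) (periodBox (d := d) N) with hL1def
  have hDφ0 : 0 ≤ Dφ := by rw [hDφ]; unfold dirSq; positivity
  have hL10 : 0 ≤ L1 := by rw [hL1def]; unfold dirL1; positivity
  have hsq : Dφ ≤ L1 ^ 2 := by
    have h := sqrt_dirSq_le_dirL1 (QbarIter L (j + 1) W Z) (periodBox (d := d) N)
    rw [← hDφ, ← hL1def] at h
    have h2 := pow_le_pow_left₀ (Real.sqrt_nonneg _) h 2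
    rwa [Real.sq_sqrt hDφ0] at h2
  have hNM : (((N * L ^ (j + 1) : ℕ) : ℝ)) ^ d = (N : ℝ) ^ d * M ^ d := by rw [hMdef]; push_cast; ring
  have hx4 : x ^ 2 * M ^ 4 ≤ 1 := by
    have h1 : 0 ≤ M ^ 2 * x := by positivity
    have h2 : M ^ 2 * x ≤ 1 := by rw [hMdef]; exact hε
    nlinarith [h1, h2]
  -- the correction's curl in ℓ¹: pointwise `2x‖λ(p.1)‖`, Cauchy–Schwarz, Poincaré, γ3's letter
  obtain ⟨hls, hlP, hl0⟩ := mem_avgKernelGauges_iff.mp hlam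
  have hG := sum_nhsNormSq_gaugeDir_le_of_isLandauB8 hL hN j hWu hWP hx hs hWx hPs hYP hlam hLan
  have hξ : ∀ z ∈ periodBox (d := d) N, bmeanIterW L (j + 1) W lam z = 0 := fun z _ => by simp only [hl0, Pi.zero_apply]
  have hPo := sum_nhsNormSq_le_four_mul_of_bmeanIterW_eq_zero hL j hWu hx hs hWx N lam hξ hPs
  rw [Nat.mul_comm] at hPo
  have hΛ : ∑ y ∈ periodBox (d := d) (N * L ^ (j + 1)), ‖lam y‖ ^ 2
      ≤ Fintype.card n * (16 * ((L : ℝ) ^ (j + 1)) ^ 4 * ∑ y ∈ periodBox (d := d) (N * L ^ (j + 1)), nhsNormSq (covDiv W Y y)) := by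
    calc ∑ y ∈ periodBox (d := d) (N * L ^ (j + 1)), ‖lam y‖ ^ 2
        ≤ ∑ y ∈ periodBox (d := d) (N * L ^ (j + 1)), Fintype.card n * nhsNormSq (lam y) := Finset.sum_le_sum fun y _ => opNorm_sq_le_card_mul_nhsNormSq _
      _ = Fintype.card n * ∑ y ∈ periodBox (d := d) (N * L ^ (j + 1)), nhsNormSq (lam y) := by rw [Finset.mul_sum]
      _ ≤ Fintype.card n * (4 * (((L : ℝ) ^ (j + 1)) ^ 2 * (4 * ((L : ℝ) ^ (j + 1)) ^ 2 * ∑ y ∈ periodBox (d := d) (N * L ^ (j + 1)), nhsNormSq (covDiv W Y y)))) :=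
          mul_le_mul_of_nonneg_left (hPo.trans (mul_le_mul_of_nonneg_left (mul_le_mul_of_nonneg_left hG (by positivity)) (by norm_num))) (Nat.cast_nonneg _)
      _ = _ := by ring
  have hD3 : ∑ p ∈ perWin d (N * L ^ (j + 1)), ‖curl W (gaugeDir W lam) p‖
      ≤ 2 * x * Fintype.card (T4AveragingDeficitWall.Plane d) * (Real.sqrt ((((N * L ^ (j + 1) : ℕ) : ℝ)) ^ d)
          * Real.sqrt (Fintype.card n * (16 * ((L : ℝ) ^ (j + 1)) ^ 4 * ∑ y ∈ periodBox (d := d) (N * L ^ (j + 1)), nhsNormSq (covDiv W Y y)))) := by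
    set S : ℝ := ∑ y ∈ periodBox (d := d) (N * L ^ (j + 1)), ‖lam y‖ with hS
    have hpt : ∀ (y : Site d) (π : T4AveragingDeficitWall.Plane d), ‖curl W (gaugeDir W lam) (y, π)‖ ≤ 2 * x * ‖lam y‖ :=
      fun y π => norm_curlAt_gaugeDir_le hWu hWx lam y (ne_of_lt π.2)
    have hsum : ∑ p ∈ perWin d (N * L ^ (j + 1)), ‖curl W (gaugeDir W lam) p‖ ≤ 2 * x * Fintype.card (T4AveragingDeficitWall.Plane d) * S := by
      unfold perWin
      rw [Finset.sum_product]
      calc ∑ y ∈ periodBox (d := d) (N * L ^ (j + 1)), ∑ π : T4AveragingDeficitWall.Plane d, ‖curl W (gaugeDir W lam) (y, π)‖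
          ≤ ∑ y ∈ periodBox (d := d) (N * L ^ (j + 1)), ∑ _π : T4AveragingDeficitWall.Plane d, 2 * x * ‖lam y‖ :=
            Finset.sum_le_sum fun y _ => Finset.sum_le_sum fun π _ => hpt y π
        _ = 2 * x * Fintype.card (T4AveragingDeficitWall.Plane d) * S := by
            simp only [Finset.sum_const, Finset.card_univ, nsmul_eq_mul, hS, Finset.mul_sum]
            exact Finset.sum_congr rfl fun y _ => by ring
    have hCS : S ≤ Real.sqrt (((((N * L ^ (j + 1) : ℕ)) : ℝ)) ^ d) * Real.sqrt (∑ y ∈ periodBox (d := d) (N * L ^ (j + 1)), ‖lam y‖ ^ 2) := by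
      have h := Real.sum_mul_le_sqrt_mul_sqrt (periodBox (d := d) (N * L ^ (j + 1))) (fun _ => (1 : ℝ)) (fun y => ‖lam y‖)
      have h1 : ∑ y ∈ periodBox (d := d) (N * L ^ (j + 1)), (1 : ℝ) * ‖lam y‖ = S := by rw [hS]; exact Finset.sum_congr rfl fun y _ => one_mul _
      have h2 : ∑ y ∈ periodBox (d := d) (N * L ^ (j + 1)), (1 : ℝ) ^ 2 = ((((N * L ^ (j + 1) : ℕ)) : ℝ)) ^ d := by
        rw [Finset.sum_const, card_periodBox, nsmul_eq_mul, one_pow, mul_one, Nat.cast_pow]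
      rw [h1, h2] at h
      exact h
    have hx2 : 0 ≤ 2 * x * Fintype.card (T4AveragingDeficitWall.Plane d) := by positivity
    exact hsum.trans ((mul_le_mul_of_nonneg_left hCS hx2).trans
      (mul_le_mul_of_nonneg_left (mul_le_mul_of_nonneg_left (Real.sqrt_le_sqrt hΛ) (Real.sqrt_nonneg _)) hx2))
  set P2 : ℝ := (Fintype.card (T4AveragingDeficitWall.Plane d) : ℝ) with hP2
  -- the correction: `2x·P2·√A·√B ≤ T` with `T = 8·P2·√(card n c_V N^d)·(M^d/M²)·L1`
  set T : ℝ := 8 * P2 * Real.sqrt (Fintype.card n * cV * (N : ℝ) ^ d) * (M ^ d / M ^ 2) * L1 with hT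
  have hT0 : 0 ≤ T := by rw [hT]; positivity
  have hA0 : 0 ≤ (((N * L ^ (j + 1) : ℕ) : ℝ)) ^ d := by positivity
  have hB : Fintype.card n * (16 * ((L : ℝ) ^ (j + 1)) ^ 4 * ∑ y ∈ periodBox (d := d) (N * L ^ (j + 1)), nhsNormSq (covDiv W Y y))
      ≤ Fintype.card n * (16 * M ^ 4 * (cV * (M ^ d / M ^ 4) * Dφ)) :=
    mul_le_mul_of_nonneg_left (mul_le_mul_of_nonneg_left (hV.trans hVφ) (by positivity)) (Nat.cast_nonneg _)
  -- `(2x·P2)²·A·B' ≤ T²` using `x²M⁴ ≤ 1` and `Dφ ≤ L1²`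
  have hX0 : 0 ≤ (Fintype.card n : ℝ) * cV * (N : ℝ) ^ d := by positivity
  have hsX : Real.sqrt (Fintype.card n * cV * (N : ℝ) ^ d) ^ 2 = Fintype.card n * cV * (N : ℝ) ^ d := Real.sq_sqrt hX0
  have hT2 : T ^ 2 = (8 : ℝ) ^ 2 * P2 ^ 2 * (Fintype.card n * cV * (N : ℝ) ^ d) * (M ^ d / M ^ 2) ^ 2 * L1 ^ 2 := by
    rw [hT]; ring_nf; rw [hsX]; ring
  have hAB : (2 * x * P2) ^ 2 * ((((N * L ^ (j + 1) : ℕ) : ℝ)) ^ d * (Fintype.card n * (16 * M ^ 4 * (cV * (M ^ d / M ^ 4) * Dφ)))) ≤ T ^ 2 := by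
    rw [hNM, hT2]
    have hcoef : 0 ≤ (8 : ℝ) ^ 2 * P2 ^ 2 * (Fintype.card n * cV * (N : ℝ) ^ d) * (M ^ d / M ^ 2) ^ 2 := by positivity
    have hK0 : 0 ≤ 4 * P2 ^ 2 * (16 * (Fintype.card n * cV * (N : ℝ) ^ d) * (M ^ d / M ^ 2) ^ 2 * Dφ) := by positivity
    calc (2 * x * P2) ^ 2 * ((N : ℝ) ^ d * M ^ d * (Fintype.card n * (16 * M ^ 4 * (cV * (M ^ d / M ^ 4) * Dφ))))
        = (x ^ 2 * M ^ 4) * (4 * P2 ^ 2 * (16 * (Fintype.card n * cV * (N : ℝ) ^ d) * (M ^ d / M ^ 2) ^ 2 * Dφ)) := by field_simp; ring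
      _ ≤ 1 * (4 * P2 ^ 2 * (16 * (Fintype.card n * cV * (N : ℝ) ^ d) * (M ^ d / M ^ 2) ^ 2 * Dφ)) := mul_le_mul_of_nonneg_right hx4 hK0
      _ = (8 : ℝ) ^ 2 * P2 ^ 2 * (Fintype.card n * cV * (N : ℝ) ^ d) * (M ^ d / M ^ 2) ^ 2 * Dφ := by ring
      _ ≤ (8 : ℝ) ^ 2 * P2 ^ 2 * (Fintype.card n * cV * (N : ℝ) ^ d) * (M ^ d / M ^ 2) ^ 2 * L1 ^ 2 := mul_le_mul_of_nonneg_left hsq hcoef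
  have hDcorr : ∑ p ∈ perWin d (N * L ^ (j + 1)), ‖curl W (gaugeDir W lam) p‖ ≤ T := by
    have hxP : 0 ≤ 2 * x * P2 := by positivity
    have h1 : ∑ p ∈ perWin d (N * L ^ (j + 1)), ‖curl W (gaugeDir W lam) p‖
        ≤ 2 * x * P2 * (Real.sqrt ((((N * L ^ (j + 1) : ℕ) : ℝ)) ^ d) * Real.sqrt (Fintype.card n * (16 * M ^ 4 * (cV * (M ^ d / M ^ 4) * Dφ)))) :=
      hD3.trans (mul_le_mul_of_nonneg_left (mul_le_mul_of_nonneg_left (Real.sqrt_le_sqrt hB) (Real.sqrt_nonneg _)) hxP)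
    refine h1.trans ?_
    -- `c·√A·√B' = √(c²·A·B') ≤ T`
    have h2 : 2 * x * P2 * (Real.sqrt ((((N * L ^ (j + 1) : ℕ) : ℝ)) ^ d) * Real.sqrt (Fintype.card n * (16 * M ^ 4 * (cV * (M ^ d / M ^ 4) * Dφ))))
        = Real.sqrt ((2 * x * P2) ^ 2) * Real.sqrt ((((N * L ^ (j + 1) : ℕ) : ℝ)) ^ d * (Fintype.card n * (16 * M ^ 4 * (cV * (M ^ d / M ^ 4) * Dφ)))) := by
      rw [Real.sqrt_sq hxP, Real.sqrt_mul hA0]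
    rw [h2, ← Real.sqrt_mul (sq_nonneg _)]
    exact (Real.sqrt_le_sqrt hAB).trans (le_of_eq (Real.sqrt_sq hT0))
  have hsum := sum_norm_curl_add_le W Y (gaugeDir W lam) (perWin d (N * L ^ (j + 1)))
  have heq : (fun y μ => Y y μ + gaugeDir W lam y μ) = Y + gaugeDir W lam := rfl
  rw [heq]
  refine hsum.trans ((add_le_add hY3 hDcorr).trans (le_of_eq ?_))
  rw [hT, hP2]; ring

end NormalPart

end

end Summit.QuantumFields.BalabanUV.T4Continuum.NE3.NormalPartB8L1
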